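import Literature.AlgebraicGeometry.Frobenioids.Thm49RightEqLeftAssembly
import Literature.AlgebraicGeometry.Frobenioids.DivisorMonoidIsoDivFrobTrivialWeak
import Literature.AlgebraicGeometry.Frobenioids.Thm49StrictlyRationalWLOGWeak
import Literature.AlgebraicGeometry.Frobenioids.DivisorMonoidRightEqLeftWeak
import Literature.AlgebraicGeometry.Frobenioids.PrimaryStepsTransportWeak
import Literature.AlgebraicGeometry.Frobenioids.Thm42iiiWeak
import HarnessLib

/-!
# [FrdI] Theorem 4.9: rows T49-L06 (`TwinPrimaryCriterion`) and the "right = left" assembly at every universally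
# Div-Frobenius-trivial object, in the WEAK setting

Mochizuki, *The geometry of Frobenioids I: the general theory*, Kyushu J. Math. **62** (2008)
293–400, §4, proof of Theorem 4.9, p. 89 l. 38 – p. 90 l. 4 ("it suffices to show, for each
`𝔭 ∈ Prime(Φ₁(A))`, the existence of twin-primary steps with zero divisor in `𝔭` that are mapped by `Ψ` to
twin-primary steps of `C₂`") [cite: MochizukiFrdI2008, Thm. 4.9 p.90].

PROOF-ONLY file (cell abc-iut, layer L1, seat abc-iut-L1-t14; row «C411iii/iv-WEAK» = the [FrdI] Thm. 4.9 /
Cor. 4.11 (iii)(iv) chain over `IsPerfFactorialWeak`, block (T3)). WEAK-HYPOTHESIS TWINS over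
`FrdI.T42.SettingWeak` (`Thm42SubWeak.lean`; "`Φ_i` perf-factorial" weakened to "`Φ_i` weakly perf-factorial",
Def. 2.4 (i) (a)(b)(c) + (d_ord) + (d_res); cell finding F-L2d2-1) of:
* `FrdI.T49.twinPrimaryCriterion_weak` — the typed row T49-L06 `FrdI.T49.TwinPrimaryCriterion` (a `Prop`
  quantifying over `T42.Setting`, `Thm49Sub.lean`; proved as `twinPrimaryCriterion_holds`,
  `TwinPrimaryCriterionProofs.lean`, seat abc-iut-w4-d105) with its binders written out over a `T42.SettingWeak`
  (the right-hand / left-hand isomorphisms of Thm. 4.2 (iii) = `PreFrobenioid.exists_rightIso_weak` /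
  `exists_leftIso_weak`, `Thm42iiiWeak.lean`, seat abc-iut-L1-t12; `Φ₁(A)_𝔭` monoprime = field (b));
* `FrdI.T49.exists_mulEquiv_right_left_of_twinPrimary_weak`, `rightEqLeftAt_of_cover_weak`,
  `exists_primesEquiv_rightEqLeftAt_of_cover_weak` — twins of `Thm49RightEqLeftAssembly.lean` (seat
  abc-iut-w4-d105), over `exists_mulEquiv_of_rightEqLeftAt_weak` (`DivisorMonoidRightEqLeftWeak.lean`),
  `SettingWeak.exists_mulEquiv_div_map_of_isDivFrobeniusTrivial` (`DivisorMonoidIsoDivFrobTrivialWeak.lean`),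
  `leftHand_of_leftHand_of_isPullbackMorphism_weak` (`Thm49StrictlyRationalWLOGWeak.lean`),
  `PreFrobenioid.existsUnique_primesEquiv_family_weak` (seat abc-iut-L1-t11) and the hypothesis-free
  `rightEqLeftAt_of_mulEquiv` (`DivisorMonoidRightEqLeftLocal.lean`).
Proofs verbatim. No new definitions; nothing of the paper restated or strengthened; nothing here is specific to
the abc programme and no side is taken on [IUTchIII] Cor. 3.12.
-/

namespace Literature.AlgebraicGeometry.Frobenioids

open CategoryTheory Opposite

namespace FrdI.T49

universe w v v' u u'

variable {D₁ : Type u} [Category.{v} D₁] {Φ₁ : D₁ᵒᵖ ⥤ CommMonCat.{w}} {C₁ : Type u'} [Category.{v'} C₁]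
  {D₂ : Type u} [Category.{v} D₂] {Φ₂ : D₂ᵒᵖ ⥤ CommMonCat.{w}} {C₂ : Type u'} [Category.{v'} C₂]
  {F₁ : C₁ ⥤ ElemFrobenioid Φ₁} {F₂ : C₂ ⥤ ElemFrobenioid Φ₂} {Ψ : C₁ ≌ C₂}

set_option backward.isDefEq.respectTransparency false in
/-- **T49-L06 `TwinPrimaryCriterion` in the WEAK setting** ([FrdI] proof of Thm. 4.9, p. 90 ll. 1–4): in a
`T42.SettingWeak`, at a Div-Frobenius-trivial `A` whose Div-identity endomorphisms `Ψ` preserves, for primes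
`𝔭`, `𝔭'` related by the clauses (a), (b) of Thm. 4.2 (ii), a twin-primary pair with zero divisor in `𝔭` mapped
by `Ψ` to a twin-primary pair forces the right-hand and left-hand isomorphisms of Thm. 4.2 (iii) at `(A, 𝔭, 𝔭')`
to coincide (`RightEqLeftAt`). The body of the typed row `FrdI.T49.TwinPrimaryCriterion` over the weak setting;
twin of `twinPrimaryCriterion_holds`. [cite: MochizukiFrdI2008, Thm. 4.9 p.90] -/
theorem twinPrimaryCriterion_weak (hS : T42.SettingWeak F₁ F₂ Ψ) {A : C₁}
    (hA : PreFrobenioid.IsDivFrobeniusTrivial F₁ A)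
    (hdivid : ∀ α : A ⟶ A, PreFrobenioid.IsDivIdentity F₁ α → PreFrobenioid.IsDivIdentity F₂ (Ψ.functor.map α))
    (𝔭 : Primes (Φ₁.obj (op (PreFrobenioid.baseObj F₁ A))))
    (𝔭' : Primes (Φ₂.obj (op (PreFrobenioid.baseObj F₂ (Ψ.functor.obj A)))))
    (he : ∀ ⦃B : C₁⦄ (φ : A ⟶ B), PreFrobenioid.IsCoAngularPreStep F₁ φ →
      (PreFrobenioid.Div F₁ φ ∈ 𝔭.submonoid ↔ PreFrobenioid.Div F₂ (Ψ.functor.map φ) ∈ 𝔭'.submonoid))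
    (he' : ∀ ⦃B : C₁⦄ (ψ : B ⟶ A), PreFrobenioid.IsCoAngularPreStep F₁ ψ →
      ((∃ y ∈ 𝔭.submonoid, pull Φ₁ (PreFrobenioid.Base F₁ ψ) y = PreFrobenioid.Div F₁ ψ) ↔
        ∃ y ∈ 𝔭'.submonoid,
          pull Φ₂ (PreFrobenioid.Base F₂ (Ψ.functor.map ψ)) y = PreFrobenioid.Div F₂ (Ψ.functor.map ψ)))
    (htwin : ∃ (B C' : C₁) (β : A ⟶ B) (γ : C' ⟶ A), IsTwinPrimary F₁ β γ ∧
      PreFrobenioid.Div F₁ β ∈ 𝔭.carrier ∧ IsTwinPrimary F₂ (Ψ.functor.map β) (Ψ.functor.map γ)) :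
    RightEqLeftAt F₁ F₂ Ψ A 𝔭 𝔭' := by
  obtain ⟨B, C', β, γ, ⟨hβs, -, hγs, -, hβγ⟩, hβ𝔭, ⟨-, -, -, -, hβγ₂⟩⟩ := htwin
  have hco : ∀ {X Y : C₁} (f : X ⟶ Y), PreFrobenioid.IsCoAngular F₁ f :=
    fun f => PreFrobenioid.isCoAngular_of_isIsotropic_codomains F₁ f fun Z _ => hS.isotropic₁ Z
  -- the right-hand and left-hand isomorphisms of Thm. 4.2 (iii)
  obtain ⟨r, hr⟩ := PreFrobenioid.exists_rightIso_weak Ψ hS.isFrobenioid₁ hS.isFrobenioid₂ hS.isotropic₁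
    hS.isotropic₂ hS.perfFactorial₁ hS.perfFactorial₂ hS.preStep_map hS.preStep_inv hS.frobeniusType_map
    hS.degFr_map hA hdivid 𝔭 𝔭' he
  obtain ⟨l, hl⟩ := PreFrobenioid.exists_leftIso_weak Ψ hS.isFrobenioid₁ hS.isFrobenioid₂ hS.isotropic₁
    hS.isotropic₂ hS.perfFactorial₁ hS.perfFactorial₂ hS.preStep_map hS.preStep_inv hS.frobeniusType_map
    hS.degFr_map hA hdivid 𝔭 𝔭' he'
  -- they agree at `t := Div β ∈ Φ₁(A)_𝔭`, `t ≠ 0`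
  have ht : PreFrobenioid.Div F₁ β ∈ 𝔭.submonoid := Submonoid.subset_closure hβ𝔭
  have hγ₂ : PreFrobenioid.IsPreStep F₂ (Ψ.functor.map γ) := hS.preStep_map γ hγs.1
  haveI : IsIso (PreFrobenioid.Base F₂ (Ψ.functor.map γ)) := hγ₂.2
  have h1 : ((r ⟨PreFrobenioid.Div F₁ β, ht⟩ : 𝔭'.submonoid) :
      Φ₂.obj (op (PreFrobenioid.baseObj F₂ (Ψ.functor.obj A)))) =
        PreFrobenioid.Div F₂ (Ψ.functor.map β) :=
    hr β ⟨hco β, hβs.1⟩ ht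
  have h2 : pull Φ₂ (PreFrobenioid.Base F₂ (Ψ.functor.map γ))
      ((l ⟨PreFrobenioid.Div F₁ β, ht⟩ : 𝔭'.submonoid) :
        Φ₂.obj (op (PreFrobenioid.baseObj F₂ (Ψ.functor.obj A)))) =
        PreFrobenioid.Div F₂ (Ψ.functor.map γ) :=
    hl γ ⟨hco γ, hγs.1⟩ _ ht (by rw [hβγ hγs.1.2, PreFrobenioid.pull_invDiv])
  have h3 : pull Φ₂ (PreFrobenioid.Base F₂ (Ψ.functor.map γ)) (PreFrobenioid.Div F₂ (Ψ.functor.map β)) =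
      PreFrobenioid.Div F₂ (Ψ.functor.map γ) := by
    rw [hβγ₂ hγ₂.2, PreFrobenioid.pull_invDiv]
  have hrl : r ⟨PreFrobenioid.Div F₁ β, ht⟩ = l ⟨PreFrobenioid.Div F₁ β, ht⟩ :=
    Subtype.ext (pull_injective_of_isIso Φ₂ (PreFrobenioid.Base F₂ (Ψ.functor.map γ))
      (by rw [h1, h3, h2]))
  have hne : (⟨PreFrobenioid.Div F₁ β, ht⟩ : 𝔭.submonoid) ≠ 1 := fun h =>
    PreFrobenioid.div_ne_one_of_isStep hS.isotropic₁ hβs (congrArg Subtype.val h)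
  -- `Φ₁(A)_𝔭` is monoprime: `r = l`
  have hrl' : r = l :=
    ((hS.perfFactorial₁ (PreFrobenioid.baseObj F₁ A)).isMonoprime 𝔭).mulEquiv_eq_of_apply_eq r l hne hrl
  refine ⟨r, hr, ?_⟩
  rw [hrl']
  exact hl



/-- (WEAK setting; twin of `exists_mulEquiv_right_left_of_twinPrimary`.) **Global right = left at a Div-Frobenius-trivial object with twin-primary witnesses** (p. 90
ll. 1–4 with Thm. 4.2 (iii)): in a `T42.SettingWeak`, at a Div-Frobenius-trivial `A` whose Div-identity
endomorphisms `Ψ` preserves, if a prime correspondence `e𝔭` satisfies the clauses (a), (b) of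
Thm. 4.2 (ii) and every prime carries twin-primary steps mapped to twin-primary steps, then ONE
isomorphism of monoids `M : Φ₁(A) ≃* Φ₂(Ψ A)` has the right-hand property on all pre-steps out of `A`
and the left-hand property on all pre-steps into `A`. [cite: MochizukiFrdI2008, Thm. 4.9 p.90] -/
theorem exists_mulEquiv_right_left_of_twinPrimary_weak (S : T42.SettingWeak F₁ F₂ Ψ) {A : C₁}
    (hA : PreFrobenioid.IsDivFrobeniusTrivial F₁ A)
    (hdivid : ∀ α : A ⟶ A, PreFrobenioid.IsDivIdentity F₁ α →
      PreFrobenioid.IsDivIdentity F₂ (Ψ.functor.map α))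
    (e𝔭 : Primes (Φ₁.obj (op (PreFrobenioid.baseObj F₁ A))) →
      Primes (Φ₂.obj (op (PreFrobenioid.baseObj F₂ (Ψ.functor.obj A)))))
    (ha : ∀ (𝔭 : Primes (Φ₁.obj (op (PreFrobenioid.baseObj F₁ A)))) ⦃B : C₁⦄ (φ : A ⟶ B),
      PreFrobenioid.IsCoAngularPreStep F₁ φ →
        (PreFrobenioid.Div F₁ φ ∈ 𝔭.submonoid ↔
          PreFrobenioid.Div F₂ (Ψ.functor.map φ) ∈ (e𝔭 𝔭).submonoid))
    (hb : ∀ (𝔭 : Primes (Φ₁.obj (op (PreFrobenioid.baseObj F₁ A)))) ⦃B : C₁⦄ (ψ : B ⟶ A),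
      PreFrobenioid.IsCoAngularPreStep F₁ ψ →
        ((∃ y ∈ 𝔭.submonoid, pull Φ₁ (PreFrobenioid.Base F₁ ψ) y = PreFrobenioid.Div F₁ ψ) ↔
          ∃ y ∈ (e𝔭 𝔭).submonoid, pull Φ₂ (PreFrobenioid.Base F₂ (Ψ.functor.map ψ)) y =
            PreFrobenioid.Div F₂ (Ψ.functor.map ψ)))
    (htwin : ∀ 𝔭 : Primes (Φ₁.obj (op (PreFrobenioid.baseObj F₁ A))),
      ∃ (B C' : C₁) (β : A ⟶ B) (γ : C' ⟶ A), IsTwinPrimary F₁ β γ ∧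
        PreFrobenioid.Div F₁ β ∈ 𝔭.carrier ∧ IsTwinPrimary F₂ (Ψ.functor.map β) (Ψ.functor.map γ)) :
    ∃ M : Φ₁.obj (op (PreFrobenioid.baseObj F₁ A)) ≃*
        Φ₂.obj (op (PreFrobenioid.baseObj F₂ (Ψ.functor.obj A))),
      (∀ ⦃B : C₁⦄ (φ : A ⟶ B), PreFrobenioid.IsPreStep F₁ φ →
          M (PreFrobenioid.Div F₁ φ) = PreFrobenioid.Div F₂ (Ψ.functor.map φ)) ∧
      ∀ ⦃B : C₁⦄ (ψ : B ⟶ A), PreFrobenioid.IsPreStep F₁ ψ →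
        ∀ y : Φ₁.obj (op (PreFrobenioid.baseObj F₁ A)),
          pull Φ₁ (PreFrobenioid.Base F₁ ψ) y = PreFrobenioid.Div F₁ ψ →
            pull Φ₂ (PreFrobenioid.Base F₂ (Ψ.functor.map ψ)) (M y) =
              PreFrobenioid.Div F₂ (Ψ.functor.map ψ) :=
  exists_mulEquiv_of_rightEqLeftAt_weak S fun 𝔭 =>
    ⟨e𝔭 𝔭, twinPrimaryCriterion_weak S hA hdivid 𝔭 (e𝔭 𝔭) (ha 𝔭) (hb 𝔭) (htwin 𝔭)⟩

/-- (WEAK setting; twin of `rightEqLeftAt_of_cover`.) **"Right = left" at every universally Div-Frobenius-trivial object, from a cover by `P`-objects**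
(p. 89 l. 38 – p. 90 l. 4, assembled): in a `T42.SettingWeak` with `Ψ` preserving and reflecting primary
pre-steps, given a prime correspondence `e` with the clauses (a), (b) of Thm. 4.2 (ii) at every object,
`Ψ` preserving the Div-identity endomorphisms of Div-Frobenius-trivial objects, and a class of objects
`P` such that every `P`-object carries twin-primary witnesses at every prime [rows T49-L07/L08′ for
`P` = strictly rational] and every universally Div-Frobenius-trivial object receives a pull-back
morphism from a `P`-object ["rational"], the slot `RightEqLeftAt F₁ F₂ Ψ A 𝔭 (e A 𝔭)` holds at every
universally Div-Frobenius-trivial `A` and every prime `𝔭` — the last hypothesis of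
`FrdI.T49.SufficesRightEqLeft`. [cite: MochizukiFrdI2008, Thm. 4.9 p.89] -/
theorem rightEqLeftAt_of_cover_weak (S : T42.SettingWeak F₁ F₂ Ψ)
    (hprim : ∀ ⦃X Y : C₁⦄ (φ : X ⟶ Y), PreFrobenioid.IsPrimaryPreStep F₁ φ →
      PreFrobenioid.IsPrimaryPreStep F₂ (Ψ.functor.map φ))
    (hprim' : ∀ ⦃X Y : C₂⦄ (φ : X ⟶ Y), PreFrobenioid.IsPrimaryPreStep F₂ φ →
      PreFrobenioid.IsPrimaryPreStep F₁ (Ψ.inverse.map φ))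
    (e : ∀ A : C₁, Primes (Φ₁.obj (op (PreFrobenioid.baseObj F₁ A))) →
      Primes (Φ₂.obj (op (PreFrobenioid.baseObj F₂ (Ψ.functor.obj A)))))
    (ha : ∀ (A : C₁) (𝔭 : Primes (Φ₁.obj (op (PreFrobenioid.baseObj F₁ A)))) ⦃B : C₁⦄ (φ : A ⟶ B),
      PreFrobenioid.IsCoAngularPreStep F₁ φ →
        (PreFrobenioid.Div F₁ φ ∈ 𝔭.submonoid ↔
          PreFrobenioid.Div F₂ (Ψ.functor.map φ) ∈ (e A 𝔭).submonoid))
    (hb : ∀ (A : C₁) (𝔭 : Primes (Φ₁.obj (op (PreFrobenioid.baseObj F₁ A)))) ⦃B : C₁⦄ (ψ : B ⟶ A),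
      PreFrobenioid.IsCoAngularPreStep F₁ ψ →
        ((∃ y ∈ 𝔭.submonoid, pull Φ₁ (PreFrobenioid.Base F₁ ψ) y = PreFrobenioid.Div F₁ ψ) ↔
          ∃ y ∈ (e A 𝔭).submonoid, pull Φ₂ (PreFrobenioid.Base F₂ (Ψ.functor.map ψ)) y =
            PreFrobenioid.Div F₂ (Ψ.functor.map ψ)))
    (hdivid : ∀ ⦃A : C₁⦄, PreFrobenioid.IsDivFrobeniusTrivial F₁ A → ∀ α : A ⟶ A,
      PreFrobenioid.IsDivIdentity F₁ α → PreFrobenioid.IsDivIdentity F₂ (Ψ.functor.map α))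
    (P : C₁ → Prop)
    (htwin : ∀ ⦃A' : C₁⦄, P A' → ∀ 𝔮 : Primes (Φ₁.obj (op (PreFrobenioid.baseObj F₁ A'))),
      ∃ (B C' : C₁) (β : A' ⟶ B) (γ : C' ⟶ A'), IsTwinPrimary F₁ β γ ∧
        PreFrobenioid.Div F₁ β ∈ 𝔮.carrier ∧ IsTwinPrimary F₂ (Ψ.functor.map β) (Ψ.functor.map γ))
    (hcover : ∀ ⦃A : C₁⦄, PreFrobenioid.IsUniversallyDivFrobeniusTrivial F₁ A →
      ∃ (A' : C₁) (ψ : A' ⟶ A), PreFrobenioid.IsPullbackMorphism F₁ ψ ∧ P A')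
    (A : C₁) (hA : PreFrobenioid.IsUniversallyDivFrobeniusTrivial F₁ A)
    (𝔭 : Primes (Φ₁.obj (op (PreFrobenioid.baseObj F₁ A)))) : RightEqLeftAt F₁ F₂ Ψ A 𝔭 (e A 𝔭) := by
  have hco : ∀ {X Y : C₁} (f : X ⟶ Y), PreFrobenioid.IsCoAngular F₁ f :=
    fun f => PreFrobenioid.isCoAngular_of_isIsotropic_codomains F₁ f fun Z _ => S.isotropic₁ Z
  -- the `P`-cover `ψ : A' → A`; `A'` is Div-Frobenius-trivial
  obtain ⟨A', ψ, hψ, hPA'⟩ := hcover hA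
  have hA' : PreFrobenioid.IsDivFrobeniusTrivial F₁ A' := hA ψ hψ
  -- global right = left at `A'` (rows T49-L06/L07, glued)
  obtain ⟨M', hM'r, hM'l⟩ := exists_mulEquiv_right_left_of_twinPrimary_weak S hA' (hdivid hA') (e A')
    (ha A') (hb A') (htwin hPA')
  -- the right-hand monoid isomorphism at `A`
  obtain ⟨M, hMr⟩ := S.exists_mulEquiv_div_map_of_isDivFrobeniusTrivial hprim hprim'
    hA.isDivFrobeniusTrivial (hdivid hA.isDivFrobeniusTrivial)
  -- transport of the left-hand property down `ψ` (row T49-L05)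
  have hMl := leftHand_of_leftHand_of_isPullbackMorphism_weak F₁ F₂ Ψ S ψ hψ M' M hM'r hMr
    (fun B' χ hχ y hy => hM'l χ hχ.2 y hy)
  -- back to the prime ray `𝔭`
  exact rightEqLeftAt_of_mulEquiv S.isFrobenioid₁ M hMr (fun B χ hχ y hy => hMl χ ⟨hco χ, hχ⟩ y hy)
    𝔭 (e A 𝔭) (ha A 𝔭)

/-- (WEAK setting; twin of `exists_primesEquiv_rightEqLeftAt_of_cover`.) The same with the prime correspondence `Ψ^Prime` of Thm. 4.2 (ii) supplied by
`PreFrobenioid.existsUnique_primesEquiv_family_weak` (row T42-L08): the last TWO data of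
`FrdI.T49.SufficesRightEqLeft` — a family `e` and the slots `RightEqLeftAt` at all universally
Div-Frobenius-trivial objects — exist together. [cite: MochizukiFrdI2008, Thm. 4.9 p.89] -/
theorem exists_primesEquiv_rightEqLeftAt_of_cover_weak (S : T42.SettingWeak F₁ F₂ Ψ)
    (hprim : ∀ ⦃X Y : C₁⦄ (φ : X ⟶ Y), PreFrobenioid.IsPrimaryPreStep F₁ φ →
      PreFrobenioid.IsPrimaryPreStep F₂ (Ψ.functor.map φ))
    (hprim' : ∀ ⦃X Y : C₂⦄ (φ : X ⟶ Y), PreFrobenioid.IsPrimaryPreStep F₂ φ →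
      PreFrobenioid.IsPrimaryPreStep F₁ (Ψ.inverse.map φ))
    (hdivid : ∀ ⦃A : C₁⦄, PreFrobenioid.IsDivFrobeniusTrivial F₁ A → ∀ α : A ⟶ A,
      PreFrobenioid.IsDivIdentity F₁ α → PreFrobenioid.IsDivIdentity F₂ (Ψ.functor.map α))
    (P : C₁ → Prop)
    (htwin : ∀ ⦃A' : C₁⦄, P A' → ∀ 𝔮 : Primes (Φ₁.obj (op (PreFrobenioid.baseObj F₁ A'))),
      ∃ (B C' : C₁) (β : A' ⟶ B) (γ : C' ⟶ A'), IsTwinPrimary F₁ β γ ∧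
        PreFrobenioid.Div F₁ β ∈ 𝔮.carrier ∧ IsTwinPrimary F₂ (Ψ.functor.map β) (Ψ.functor.map γ))
    (hcover : ∀ ⦃A : C₁⦄, PreFrobenioid.IsUniversallyDivFrobeniusTrivial F₁ A →
      ∃ (A' : C₁) (ψ : A' ⟶ A), PreFrobenioid.IsPullbackMorphism F₁ ψ ∧ P A') :
    ∃ e : ∀ A : C₁, Primes (Φ₁.obj (op (PreFrobenioid.baseObj F₁ A))) ≃
        Primes (Φ₂.obj (op (PreFrobenioid.baseObj F₂ (Ψ.functor.obj A)))),
      (∀ (A : C₁) (𝔭 : Primes (Φ₁.obj (op (PreFrobenioid.baseObj F₁ A)))),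
        (∀ ⦃B : C₁⦄ (φ : A ⟶ B), PreFrobenioid.IsCoAngularPreStep F₁ φ →
            (PreFrobenioid.Div F₁ φ ∈ 𝔭.submonoid ↔
              PreFrobenioid.Div F₂ (Ψ.functor.map φ) ∈ (e A 𝔭).submonoid)) ∧
        ∀ ⦃B : C₁⦄ (ψ : B ⟶ A), PreFrobenioid.IsCoAngularPreStep F₁ ψ →
          ((∃ y ∈ 𝔭.submonoid, pull Φ₁ (PreFrobenioid.Base F₁ ψ) y = PreFrobenioid.Div F₁ ψ) ↔
            ∃ y ∈ (e A 𝔭).submonoid, pull Φ₂ (PreFrobenioid.Base F₂ (Ψ.functor.map ψ)) y =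
              PreFrobenioid.Div F₂ (Ψ.functor.map ψ))) ∧
      ∀ (A : C₁), PreFrobenioid.IsUniversallyDivFrobeniusTrivial F₁ A →
        ∀ 𝔭 : Primes (Φ₁.obj (op (PreFrobenioid.baseObj F₁ A))), RightEqLeftAt F₁ F₂ Ψ A 𝔭 (e A 𝔭) := by
  obtain ⟨e, he⟩ := (PreFrobenioid.existsUnique_primesEquiv_family_weak Ψ S.isFrobenioid₁ S.isFrobenioid₂
    S.perfect₁ S.perfect₂ S.isotropic₁ S.isotropic₂ S.perfFactorial₁ S.perfFactorial₂ S.step_map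
    S.step_inv S.preStep_map S.preStep_inv hprim hprim').exists
  exact ⟨e, he, fun A hA 𝔭 => rightEqLeftAt_of_cover_weak S hprim hprim' (fun A => e A)
    (fun A 𝔭 => (he A 𝔭).1) (fun A 𝔭 => (he A 𝔭).2) hdivid P htwin hcover A hA 𝔭⟩

end FrdI.T49

end Literature.AlgebraicGeometry.Frobenioids
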